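import Mathlib.InformationTheory.Hamming
import Mathlib.Data.Set.Finite.Range
import Literature.InformationTheory.QuantumCodes.CSS
import Literature.InformationTheory.QuantumCodes.HypergraphProductKernels
import Literature.InformationTheory.QuantumCodes.OrbitReduction
import HarnessLib

/-!
# Automorphisms act linearly on logical labels (CERT-FORMAT L6, `bz_aut` certificates)

A *permutation automorphism* of a check matrix `H` is a qubit permutation `σ` together with a check
**map** `ρ` (rows to rows, not necessarily a bijection — exactly what a certificate checker verifies:
"row `i` permuted by `σ` is row `ρ i`") with `H (ρ i) (σ j) = H i j`, i.e. `H.submatrix ρ σ = H`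
[BravyiEtAl2024, SI §9.2: "a permutation of the physical qubits that is equivalent to a permutation of
the checks"].  `OrbitReduction.lean` treats bijective `ρ`; here we first remove that restriction
(`exists_submatrix_symm_eq_self`: for finitely many rows the inverse permutation is again an automorphism
with SOME row map, by a counting argument on the finite set of row vectors), so kernel, row space and the
set of nontrivial `Z`- and `X`-logicals are preserved in both directions
(`mulVec_comp_equiv_symm_eq_zero_iff_of_rowMap`, `comp_equiv_symm_mem_rowSpace_iff_of_rowMap`,
`CSSCode.zLogical_comp_equiv_symm_of_rowMap`).

Then the **label action** (Bravyi et al.: "automorphism operations take `X̄` to `X̄` and `Z̄` to `Z̄` …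
must hence be logical CNOT circuits", i.e. act LINEARLY on the logical operators).  Fix `k` logical
`X`-operators and `k` logical `Z`-operators as the rows of matrices `LX LZ : Matrix κ Q 𝔽₂`, with
`H^Z LX_a = 0` and the expansion property "every `z ∈ ker H^X` is `(LX z)ᵀ LZ` modulo `rs H^Z`"
(lemma L1 of the certificate format; `Census/CertLogical.lean` proves it from the rank certificates).
The *label* of `z ∈ ker H^X` is `LX *ᵥ z ∈ 𝔽₂^κ` (`a ↦ ⟨LX_a, z⟩`).  For an automorphism `(σ, ρ^Z)` of `H^Z`:

  `LX *ᵥ (z ∘ σ⁻¹) = ρ_σ *ᵥ (LX *ᵥ z)`,  `ρ_σ := LX * (LZ.submatrix id σ⁻¹)ᵀ`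
  (`(ρ_σ) a j = ⟨LX_a, LZ_j ∘ σ⁻¹⟩` = the label of the transported `j`-th logical)

(`CSSCode.label_comp_equiv_symm`), and the **cover step** of the `bz_aut` certificate
(`CSSCode.lt_hammingNorm_of_label_cover`, `CSSCode.le_dZ_of_label_cover` + `X` twins): if every
nonzero label `λ` is certified directly or after transport (`Cert λ ∨ ∃ a, Cert (ρ_{σ_a} λ)`), where
"certified" means "every `z ∈ ker H^X` of weight `≤ wmax` with that label is a stabilizer", then every
nontrivial `Z`-logical has weight `> wmax`.  No closure / group / orbit property of the listed
automorphisms is used.  Everything is PROVED; no definitions, no named facts.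

## References
* [BravyiEtAl2024] S. Bravyi, A. W. Cross, J. M. Gambetta, D. Maslov, P. Rall, T. J. Yoder,
  *High-threshold and low-overhead fault-tolerant quantum memory*, Nature 627 (2024) 778–782 =
  arXiv:2308.07915; Supplementary Information §9.2 "Logical gates based on automorphisms" (held text
  chunk p0021 L60–62: automorphism = qubit permutation ≡ check permutation; chunk p0022 L8–16:
  "An automorphism defined by an element s ∈ M transforms X̄_{n_i} → X̄_{s n_i}, Z̄_{m_i} → Z̄_{s m_i} …
  automorphism operations take X̄ to X̄ and Z̄ to Z̄ … must hence be logical CNOT circuits up to a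
  logical Pauli correction").
* [Grassl2006] M. Grassl, *Searching for linear codes with large minimum distance*, in: Discovering
  Mathematics with Magma (Springer 2006), §2.2 p. 294 (chunk p0240 L7–13): symmetry reduction of
  minimum-weight enumeration by code automorphisms (the use made of the label action here).

## Mathlib / tree search (2026-08-26)
Mathlib: `Matrix.submatrix_mulVec_equiv` (row map may be any function), `Matrix.submatrix_vecMul_equiv`,
`Finite.surjective_of_injective`, `Matrix.mulVec_mulVec`, `Matrix.mulVec_transpose`.  Tree (reused):
`rowSpace`/`pcCode`/`mem_rowSpace_iff` (`HypergraphProduct.lean`), `hammingNorm_comp_equiv`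
(`HypergraphProductKernels.lean`), `CSSCode`, `dZ`, `le_dZ`, `dotProduct_eq_zero_of_mem_rowSpace`
(`CSS.lean`), `mulVec_comp_equiv_symm_eq_zero_iff` etc. for bijective `ρ` (`OrbitReduction.lean`).
`lean search "label|rowMap|logical CNOT"` in `InformationTheory`: the only label vocabulary is the
checker-side `Census/CertLogical.lean` (`logOK`, `exists_coeffs_of_ker` = lemma L1), which this file
does not import (Literature may not import Summits); its conclusion is the hypothesis `hexp` below.
-/

namespace Literature.InformationTheory.QuantumCodes

open Matrix

/-! ### Automorphisms with a row MAP: transport of kernel and row space in both directions -/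

section RowMap

variable {ι K r : Type*}

/-- Row `i` transported by the qubit permutation is row `ρ i`: `H i ∘ σ⁻¹ = H (ρ i)` — the defining
check of a certificate's automorphism entry.
[cite: BravyiEtAl2024, SI §9.2 "An automorphism … is a permutation of the physical qubits that is equivalent to a permutation of the checks" (arXiv:2308.07915, chunk p0021 L60)] -/
theorem row_comp_equiv_symm_of_rowMap {H : Matrix r ι K} {ρ : r → r} {σ : ι ≃ ι}
    (h : H.submatrix ρ σ = H) (i : r) : H i ∘ σ.symm = H (ρ i) := by
  funext j
  have hij := congr_fun (congr_fun h i) (σ.symm j)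
  simp only [submatrix_apply, Equiv.apply_symm_apply] at hij
  exact hij.symm

/-- **Kernel transport along `σ`** (row map any function): `H (v ∘ σ) = (H v) ∘ ρ`.
[cite: BravyiEtAl2024, SI §9.2 (arXiv:2308.07915, chunk p0021 L60–62)] -/
theorem mulVec_comp_equiv_of_rowMap [Fintype ι] [NonUnitalNonAssocSemiring K] {H : Matrix r ι K}
    {ρ : r → r} {σ : ι ≃ ι} (h : H.submatrix ρ σ = H) (v : ι → K) :
    H *ᵥ (v ∘ σ) = (H *ᵥ v) ∘ ρ := by
  have key := submatrix_mulVec_equiv H (v ∘ σ) ρ σ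
  rw [h] at key
  rw [key, show (v ∘ σ) ∘ σ.symm = v from funext fun j => by simp]

/-- Hence `H v = 0 ⟹ H (v ∘ σ) = 0`. [cite: BravyiEtAl2024, SI §9.2 (arXiv:2308.07915, chunk p0021 L60–62)] -/
theorem mulVec_comp_equiv_eq_zero_of_rowMap [Fintype ι] [NonUnitalNonAssocSemiring K]
    {H : Matrix r ι K} {ρ : r → r} {σ : ι ≃ ι} (h : H.submatrix ρ σ = H) {v : ι → K}
    (hv : H *ᵥ v = 0) : H *ᵥ (v ∘ σ) = 0 := by
  rw [mulVec_comp_equiv_of_rowMap h, hv]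
  rfl

/-- **Row-space transport along `σ⁻¹`** (row map any function): `v ∈ rs H ⟹ v ∘ σ⁻¹ ∈ rs H` (each row
goes to a row). [cite: BravyiEtAl2024, SI §9.2 "the stabilizers are transformed … which is the same as permuting the X checks" (arXiv:2308.07915, chunk p0022 L8)] -/
theorem comp_equiv_symm_mem_rowSpace_of_rowMap [Field K] [Fintype r] {H : Matrix r ι K} {ρ : r → r}
    {σ : ι ≃ ι} (h : H.submatrix ρ σ = H) {v : ι → K} (hv : v ∈ rowSpace H) :
    v ∘ σ.symm ∈ rowSpace H := by
  -- `· ∘ σ⁻¹` is linear and maps every row into the set of rows, hence the span into the span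
  have hrs : rowSpace H = Submodule.span K (Set.range H.row) := range_vecMulLinear H
  let F : (ι → K) →ₗ[K] (ι → K) := LinearMap.funLeft K K σ.symm
  have hF : ∀ x, F x = x ∘ σ.symm := fun x => rfl
  have hmap : Submodule.map F (Submodule.span K (Set.range H.row)) ≤
      Submodule.span K (Set.range H.row) := by
    rw [Submodule.map_span]
    refine Submodule.span_mono ?_
    rintro _ ⟨_, ⟨i, rfl⟩, rfl⟩
    exact ⟨ρ i, by rw [hF]; exact (row_comp_equiv_symm_of_rowMap h i).symm⟩
  rw [hrs] at hv ⊢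
  rw [← hF]
  exact hmap ⟨v, hv, rfl⟩

/-- **The inverse of an automorphism is an automorphism (with some row map).**  If `H (ρ i) (σ j) = H i j`
for a row map `ρ` and `H` has finitely many rows, then `H (ρ' i) (σ⁻¹ j) = H i j` for some row map `ρ'`:
`x ↦ x ∘ σ⁻¹` is injective on the finite set of row vectors and maps it into itself, hence onto itself.
[cite: BravyiEtAl2024, SI §9.2 (arXiv:2308.07915, chunk p0021 L60–62)] -/
theorem exists_submatrix_symm_eq_self_of_rowMap [Finite r] {H : Matrix r ι K} {ρ : r → r} {σ : ι ≃ ι}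
    (h : H.submatrix ρ σ = H) : ∃ ρ' : r → r, H.submatrix ρ' σ.symm = H := by
  classical
  have hrow := row_comp_equiv_symm_of_rowMap h
  have hS : ∀ x ∈ Set.range H, x ∘ σ.symm ∈ Set.range H := by
    rintro _ ⟨i, rfl⟩
    exact ⟨ρ i, (hrow i).symm⟩
  let f : Set.range H → Set.range H := fun x => ⟨x.1 ∘ σ.symm, hS x.1 x.2⟩
  have hf : Function.Injective f := by
    intro x y hxy
    apply Subtype.ext
    have hxy' : x.1 ∘ σ.symm = y.1 ∘ σ.symm := congrArg Subtype.val hxy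
    funext j
    have := congr_fun hxy' (σ j)
    simpa using this
  have hsurj := Finite.surjective_of_injective hf
  choose g hg using fun i' : r => hsurj ⟨H i', ⟨i', rfl⟩⟩
  choose ρ' hρ' using fun i' : r => (g i').2
  refine ⟨ρ', ?_⟩
  ext i' j
  have h1 : (g i').1 ∘ σ.symm = H i' := congrArg Subtype.val (hg i')
  rw [← hρ' i'] at h1
  exact congr_fun h1 j

/-- A row-map automorphism preserves the kernel in both directions: `H (v ∘ σ⁻¹) = 0 ↔ H v = 0`.
[cite: BravyiEtAl2024, SI §9.2 (arXiv:2308.07915, chunk p0021 L60–62)] -/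
theorem mulVec_comp_equiv_symm_eq_zero_iff_of_rowMap [Fintype ι] [Finite r] [NonUnitalNonAssocSemiring K]
    {H : Matrix r ι K} {ρ : r → r} {σ : ι ≃ ι} (h : H.submatrix ρ σ = H) (v : ι → K) :
    H *ᵥ (v ∘ σ.symm) = 0 ↔ H *ᵥ v = 0 := by
  obtain ⟨ρ', h'⟩ := exists_submatrix_symm_eq_self_of_rowMap h
  refine ⟨fun hv => ?_, fun hv => mulVec_comp_equiv_eq_zero_of_rowMap h' hv⟩
  have := mulVec_comp_equiv_eq_zero_of_rowMap h hv
  rwa [show (v ∘ σ.symm) ∘ σ = v from funext fun j => by simp] at this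

/-- A row-map automorphism preserves the row space in both directions: `v ∘ σ⁻¹ ∈ rs H ↔ v ∈ rs H`.
[cite: BravyiEtAl2024, SI §9.2 (arXiv:2308.07915, chunk p0022 L8)] -/
theorem comp_equiv_symm_mem_rowSpace_iff_of_rowMap [Field K] [Fintype r] {H : Matrix r ι K}
    {ρ : r → r} {σ : ι ≃ ι} (h : H.submatrix ρ σ = H) (v : ι → K) :
    v ∘ σ.symm ∈ rowSpace H ↔ v ∈ rowSpace H := by
  obtain ⟨ρ', h'⟩ := exists_submatrix_symm_eq_self_of_rowMap h
  refine ⟨fun hv => ?_, comp_equiv_symm_mem_rowSpace_of_rowMap h⟩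
  have := comp_equiv_symm_mem_rowSpace_of_rowMap h' hv
  rwa [show (v ∘ σ.symm) ∘ σ.symm.symm = v from funext fun j => by simp] at this

end RowMap

/-! ### CSS codes: transport of logicals and the label action -/

namespace CSSCode

variable {RX RZ Q : Type*} [Fintype Q] [Fintype RX] [Fintype RZ]

/-- **L6, first half.** A qubit permutation mapping `X`-rows to `X`-rows and `Z`-rows to `Z`-rows (row
maps any functions) maps nontrivial `Z`-logicals to nontrivial `Z`-logicals (of the same weight:
`hammingNorm_comp_equiv`). [cite: BravyiEtAl2024, SI §9.2 "The Z stabilizers are also permuted … so the described circuit indeed implements an automorphism" (arXiv:2308.07915, chunk p0022 L8)] -/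
theorem zLogical_comp_equiv_symm_of_rowMap (C : CSSCode RX RZ Q) {σ : Q ≃ Q} {ρX : RX → RX}
    {ρZ : RZ → RZ} (hX : C.HX.submatrix ρX σ = C.HX) (hZ : C.HZ.submatrix ρZ σ = C.HZ)
    {v : Q → ZMod 2} (hv : C.HX *ᵥ v = 0 ∧ v ∉ C.rowSpZ) :
    C.HX *ᵥ (v ∘ σ.symm) = 0 ∧ v ∘ σ.symm ∉ C.rowSpZ :=
  ⟨(mulVec_comp_equiv_symm_eq_zero_iff_of_rowMap hX v).2 hv.1,
    fun h => hv.2 ((comp_equiv_symm_mem_rowSpace_iff_of_rowMap hZ v).1 h)⟩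

/-- `X`-side twin of `zLogical_comp_equiv_symm_of_rowMap`.
[cite: BravyiEtAl2024, SI §9.2 (arXiv:2308.07915, chunk p0022 L8)] -/
theorem xLogical_comp_equiv_symm_of_rowMap (C : CSSCode RX RZ Q) {σ : Q ≃ Q} {ρX : RX → RX}
    {ρZ : RZ → RZ} (hX : C.HX.submatrix ρX σ = C.HX) (hZ : C.HZ.submatrix ρZ σ = C.HZ)
    {v : Q → ZMod 2} (hv : C.HZ *ᵥ v = 0 ∧ v ∉ C.rowSpX) :
    C.HZ *ᵥ (v ∘ σ.symm) = 0 ∧ v ∘ σ.symm ∉ C.rowSpX :=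
  C.swap.zLogical_comp_equiv_symm_of_rowMap hZ hX hv

variable {κ : Type*} [Fintype κ]

omit [Fintype RX] [Fintype κ] in
/-- Labels vanish on stabilizers: if `H^Z LX_a = 0` for every `a` then `LX *ᵥ u = 0` for `u ∈ rs H^Z`.
[cite: BravyiEtAl2024, SI §9.1 (arXiv:2308.07915, chunk p0021 L55: the logical operators X̄_{n_i}, Z̄_{m_j} pair as "n_iᵀ m_j ∈ fh exactly when i = j")] -/
theorem label_eq_zero_of_mem_rowSpZ (C : CSSCode RX RZ Q) {LX : Matrix κ Q (ZMod 2)}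
    (hLX : ∀ a, C.HZ *ᵥ LX a = 0) {u : Q → ZMod 2} (hu : u ∈ C.rowSpZ) : LX *ᵥ u = 0 := by
  funext a
  exact dotProduct_eq_zero_of_mem_rowSpace hu (hLX a)

omit [Fintype RX] in
/-- Under the expansion property (L1) the label decides triviality: `z ∈ ker H^X` is a stabilizer iff
its label `LX *ᵥ z` vanishes. [cite: BravyiEtAl2024, SI §9.1 (arXiv:2308.07915, chunk p0021 L55)] -/
theorem mem_rowSpZ_iff_label_eq_zero (C : CSSCode RX RZ Q) {LX LZ : Matrix κ Q (ZMod 2)}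
    (hLX : ∀ a, C.HZ *ᵥ LX a = 0)
    (hexp : ∀ z, C.HX *ᵥ z = 0 → z - (LX *ᵥ z) ᵥ* LZ ∈ C.rowSpZ)
    {z : Q → ZMod 2} (hz : C.HX *ᵥ z = 0) : z ∈ C.rowSpZ ↔ LX *ᵥ z = 0 := by
  refine ⟨C.label_eq_zero_of_mem_rowSpZ hLX, fun h0 => ?_⟩
  have := hexp z hz
  rwa [h0, zero_vecMul, sub_zero] at this

omit [Fintype RX] [Fintype RZ] [Fintype κ] in
/-- The entries of the label-action matrix: `(LX * (LZ.submatrix id σ⁻¹)ᵀ) a j = ⟨LX_a, LZ_j ∘ σ⁻¹⟩`, the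
`a`-th label bit of the transported `j`-th logical `Z`-operator (what a `bz_aut` checker computes as
"column `j` of `ρ_σ`"). [cite: BravyiEtAl2024, SI §9.2 "An automorphism defined by an element s ∈ M transforms X̄_{n_i} → X̄_{s n_i}, Z̄_{m_i} → Z̄_{s m_i}" (arXiv:2308.07915, chunk p0022 L14)] -/
theorem labelAction_apply (LX LZ : Matrix κ Q (ZMod 2)) (σ : Q ≃ Q) (a j : κ) :
    (LX * (LZ.submatrix id σ.symm)ᵀ) a j = LX a ⬝ᵥ (LZ j ∘ σ.symm) := by
  simp only [mul_apply, transpose_apply, submatrix_apply, id_eq, dotProduct, Function.comp_apply]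

omit [Fintype RX] in
/-- **L6, label action.**  Let `(σ, ρ^Z)` be a row-map automorphism of `H^Z`, `LX` logical
`X`-operators with `H^Z LX_a = 0`, and suppose every `z ∈ ker H^X` equals `(LX z)ᵀ LZ` modulo `rs H^Z`
(expansion property L1).  Then the label of the transported vector is a LINEAR function of the label:
`LX *ᵥ (z ∘ σ⁻¹) = ρ_σ *ᵥ (LX *ᵥ z)` with `ρ_σ = LX * (LZ.submatrix id σ⁻¹)ᵀ`.
[cite: BravyiEtAl2024, SI §9.2 "automorphism operations take X̄ to X̄ and Z̄ to Z̄ … must hence be logical CNOT circuits up to a logical Pauli correction" (arXiv:2308.07915, chunk p0022 L14–16)] -/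
theorem label_comp_equiv_symm (C : CSSCode RX RZ Q) {LX LZ : Matrix κ Q (ZMod 2)}
    (hLX : ∀ a, C.HZ *ᵥ LX a = 0)
    (hexp : ∀ z, C.HX *ᵥ z = 0 → z - (LX *ᵥ z) ᵥ* LZ ∈ C.rowSpZ)
    {σ : Q ≃ Q} {ρZ : RZ → RZ} (hZ : C.HZ.submatrix ρZ σ = C.HZ)
    {z : Q → ZMod 2} (hz : C.HX *ᵥ z = 0) :
    LX *ᵥ (z ∘ σ.symm) = (LX * (LZ.submatrix id σ.symm)ᵀ) *ᵥ (LX *ᵥ z) := by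
  set lam := LX *ᵥ z with hlam
  -- `z = s + lamᵀ LZ` with `s ∈ rs H^Z`; transport both summands
  have hs : (z - lam ᵥ* LZ) ∘ σ.symm ∈ C.rowSpZ :=
    comp_equiv_symm_mem_rowSpace_of_rowMap hZ (hexp z hz)
  have hsplit : z ∘ σ.symm = (z - lam ᵥ* LZ) ∘ σ.symm + (lam ᵥ* LZ) ∘ σ.symm := by
    funext j; simp
  have hvec : (lam ᵥ* LZ) ∘ σ.symm = lam ᵥ* LZ.submatrix id σ.symm := by
    have := submatrix_vecMul_equiv LZ lam (Equiv.refl κ) σ.symm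
    simp only [Equiv.refl_symm, Equiv.coe_refl, Function.comp_id] at this
    exact this.symm
  rw [hsplit, mulVec_add, C.label_eq_zero_of_mem_rowSpZ hLX hs, zero_add, hvec, ← mulVec_transpose,
    mulVec_mulVec]

/-- **L6, cover step of a `bz_aut` certificate (`Z` side).**  Data: logical bases `LX, LZ` (rows) with
`H^Z LX_a = 0` and the expansion property L1; a family of row-map automorphisms `(σ_a, ρ^X_a, ρ^Z_a)`;
a predicate `Cert` on labels such that every `z ∈ ker H^X` of weight `≤ wmax` with a certified label is a
stabilizer (the per-block enumeration, L5); and the cover "every nonzero label is certified directly or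
after transport by some listed automorphism".  Then every nontrivial `Z`-logical has weight `> wmax`.
No closure, inverse or orbit property of the family is needed.
[cite: Grassl2006, §2.2 "Cyclic codes" p. 294 (chunk p0240 L7–13: symmetry reduction of minimum-weight enumeration by code automorphisms)] [cite: BravyiEtAl2024, SI §9.2 (arXiv:2308.07915, chunk p0022 L8–16)] -/
theorem lt_hammingNorm_of_label_cover (C : CSSCode RX RZ Q) {LX LZ : Matrix κ Q (ZMod 2)}
    (hLX : ∀ a, C.HZ *ᵥ LX a = 0)
    (hexp : ∀ z, C.HX *ᵥ z = 0 → z - (LX *ᵥ z) ᵥ* LZ ∈ C.rowSpZ)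
    {A : Type*} {σ : A → Q ≃ Q} {ρX : A → RX → RX} {ρZ : A → RZ → RZ}
    (hσX : ∀ a, C.HX.submatrix (ρX a) (σ a) = C.HX) (hσZ : ∀ a, C.HZ.submatrix (ρZ a) (σ a) = C.HZ)
    {wmax : ℕ} {Cert : (κ → ZMod 2) → Prop}
    (hCert : ∀ z, C.HX *ᵥ z = 0 → hammingNorm z ≤ wmax → Cert (LX *ᵥ z) → z ∈ C.rowSpZ)
    (hcover : ∀ lam : κ → ZMod 2, lam ≠ 0 →
      Cert lam ∨ ∃ a, Cert ((LX * (LZ.submatrix id (σ a).symm)ᵀ) *ᵥ lam))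
    {z : Q → ZMod 2} (hz : C.HX *ᵥ z = 0) (hz' : z ∉ C.rowSpZ) : wmax < hammingNorm z := by
  by_contra hle
  rw [not_lt] at hle
  have hlam : LX *ᵥ z ≠ 0 := fun h0 => hz' ((C.mem_rowSpZ_iff_label_eq_zero hLX hexp hz).2 h0)
  rcases hcover _ hlam with hc | ⟨a, hc⟩
  · exact hz' (hCert z hz hle hc)
  · have hz1 := C.zLogical_comp_equiv_symm_of_rowMap (hσX a) (hσZ a) ⟨hz, hz'⟩
    rw [← C.label_comp_equiv_symm hLX hexp (hσZ a) hz] at hc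
    exact hz1.2 (hCert _ hz1.1 ((hammingNorm_comp_equiv z (σ a)).le.trans hle) hc)

/-- **Certificate form (`Z` side):** under the hypotheses of `lt_hammingNorm_of_label_cover`, if some
`Z`-logical exists then `wmax + 1 ≤ d^Z`. [cite: Grassl2006, §2.2 p. 294 (chunk p0240 L7–13)] [cite: BravyiEtAl2024, SI §9.2 (arXiv:2308.07915, chunk p0022 L8–16)] -/
theorem le_dZ_of_label_cover (C : CSSCode RX RZ Q) {LX LZ : Matrix κ Q (ZMod 2)}
    (hLX : ∀ a, C.HZ *ᵥ LX a = 0)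
    (hexp : ∀ z, C.HX *ᵥ z = 0 → z - (LX *ᵥ z) ᵥ* LZ ∈ C.rowSpZ)
    {A : Type*} {σ : A → Q ≃ Q} {ρX : A → RX → RX} {ρZ : A → RZ → RZ}
    (hσX : ∀ a, C.HX.submatrix (ρX a) (σ a) = C.HX) (hσZ : ∀ a, C.HZ.submatrix (ρZ a) (σ a) = C.HZ)
    {wmax : ℕ} {Cert : (κ → ZMod 2) → Prop}
    (hCert : ∀ z, C.HX *ᵥ z = 0 → hammingNorm z ≤ wmax → Cert (LX *ᵥ z) → z ∈ C.rowSpZ)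
    (hcover : ∀ lam : κ → ZMod 2, lam ≠ 0 →
      Cert lam ∨ ∃ a, Cert ((LX * (LZ.submatrix id (σ a).symm)ᵀ) *ᵥ lam))
    (hex : ∃ v : Q → ZMod 2, C.HX *ᵥ v = 0 ∧ v ∉ C.rowSpZ) : wmax + 1 ≤ C.dZ :=
  C.le_dZ hex fun _ hv hv' => C.lt_hammingNorm_of_label_cover hLX hexp hσX hσZ hCert hcover hv hv'

/-- **Cover step, `X` side** (roles of `H^X, LX` and `H^Z, LZ` exchanged: labels of `X`-logicals
`x ∈ ker H^Z` are `LZ *ᵥ x`, transported logicals are the rows of `LX`).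
[cite: Grassl2006, §2.2 p. 294 (chunk p0240 L7–13)] [cite: BravyiEtAl2024, SI §9.2 (arXiv:2308.07915, chunk p0022 L8–16)] -/
theorem lt_hammingNorm_of_label_cover_X (C : CSSCode RX RZ Q) {LX LZ : Matrix κ Q (ZMod 2)}
    (hLZ : ∀ a, C.HX *ᵥ LZ a = 0)
    (hexp : ∀ x, C.HZ *ᵥ x = 0 → x - (LZ *ᵥ x) ᵥ* LX ∈ C.rowSpX)
    {A : Type*} {σ : A → Q ≃ Q} {ρX : A → RX → RX} {ρZ : A → RZ → RZ}
    (hσX : ∀ a, C.HX.submatrix (ρX a) (σ a) = C.HX) (hσZ : ∀ a, C.HZ.submatrix (ρZ a) (σ a) = C.HZ)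
    {wmax : ℕ} {Cert : (κ → ZMod 2) → Prop}
    (hCert : ∀ x, C.HZ *ᵥ x = 0 → hammingNorm x ≤ wmax → Cert (LZ *ᵥ x) → x ∈ C.rowSpX)
    (hcover : ∀ lam : κ → ZMod 2, lam ≠ 0 →
      Cert lam ∨ ∃ a, Cert ((LZ * (LX.submatrix id (σ a).symm)ᵀ) *ᵥ lam))
    {x : Q → ZMod 2} (hx : C.HZ *ᵥ x = 0) (hx' : x ∉ C.rowSpX) : wmax < hammingNorm x :=
  C.swap.lt_hammingNorm_of_label_cover hLZ hexp hσZ hσX hCert hcover hx hx'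

/-- **Certificate form (`X` side):** `wmax + 1 ≤ d^X`.
[cite: Grassl2006, §2.2 p. 294 (chunk p0240 L7–13)] [cite: BravyiEtAl2024, SI §9.2 (arXiv:2308.07915, chunk p0022 L8–16)] -/
theorem le_dX_of_label_cover (C : CSSCode RX RZ Q) {LX LZ : Matrix κ Q (ZMod 2)}
    (hLZ : ∀ a, C.HX *ᵥ LZ a = 0)
    (hexp : ∀ x, C.HZ *ᵥ x = 0 → x - (LZ *ᵥ x) ᵥ* LX ∈ C.rowSpX)
    {A : Type*} {σ : A → Q ≃ Q} {ρX : A → RX → RX} {ρZ : A → RZ → RZ}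
    (hσX : ∀ a, C.HX.submatrix (ρX a) (σ a) = C.HX) (hσZ : ∀ a, C.HZ.submatrix (ρZ a) (σ a) = C.HZ)
    {wmax : ℕ} {Cert : (κ → ZMod 2) → Prop}
    (hCert : ∀ x, C.HZ *ᵥ x = 0 → hammingNorm x ≤ wmax → Cert (LZ *ᵥ x) → x ∈ C.rowSpX)
    (hcover : ∀ lam : κ → ZMod 2, lam ≠ 0 →
      Cert lam ∨ ∃ a, Cert ((LZ * (LX.submatrix id (σ a).symm)ᵀ) *ᵥ lam))
    (hex : ∃ v : Q → ZMod 2, C.HZ *ᵥ v = 0 ∧ v ∉ C.rowSpX) : wmax + 1 ≤ C.dX := by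
  rw [← dZ_swap]
  exact C.swap.le_dZ_of_label_cover hLZ hexp hσZ hσX hCert hcover hex


/-! ### Discharging the expansion hypothesis from lemma L1 (appended 2026-08-26) -/

omit [Fintype RX] in
/-- **L1 ⇒ the expansion hypothesis.**  If the logical bases pair to the identity (`LX LZᵀ = 1`, i.e.
`⟨LX_a, LZ_j⟩ = [a = j]`), `H^Z LX_a = 0`, and `z` is a stabilizer plus SOME combination `Σ cᵢ LZᵢ` of the
logical `Z`-operators (lemma L1 of the certificate format, e.g. `Census/CertLogical.exists_coeffs_of_ker`),
then the coefficients are the label: `z − (LX z)ᵀ LZ ∈ rs H^Z` — the hypothesis `hexp` of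
`label_comp_equiv_symm` / `lt_hammingNorm_of_label_cover`.
[cite: BravyiEtAl2024, SI §9.1 (arXiv:2308.07915, chunk p0021 L55: "X̄_{n_i} anticommutes with Z̄_{m_j} exactly when i = j")] -/
theorem sub_label_vecMul_mem_rowSpZ [DecidableEq κ] (C : CSSCode RX RZ Q) {LX LZ : Matrix κ Q (ZMod 2)}
    (hLX : ∀ a, C.HZ *ᵥ LX a = 0) (hpair : LX * LZᵀ = 1) {z : Q → ZMod 2}
    (hdec : ∃ c : κ → ZMod 2, z - ∑ i, c i • LZ i ∈ C.rowSpZ) :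
    z - (LX *ᵥ z) ᵥ* LZ ∈ C.rowSpZ := by
  obtain ⟨c, hc⟩ := hdec
  rw [← vecMul_eq_sum] at hc
  have h0 : LX *ᵥ (z - c ᵥ* LZ) = 0 := C.label_eq_zero_of_mem_rowSpZ hLX hc
  rw [mulVec_sub, sub_eq_zero, ← mulVec_transpose, mulVec_mulVec, hpair, one_mulVec] at h0
  rwa [h0]

omit [Fintype RZ] in
/-- `X`-side twin of `sub_label_vecMul_mem_rowSpZ` (labels of `X`-logicals are `LZ *ᵥ x`).
[cite: BravyiEtAl2024, SI §9.1 (arXiv:2308.07915, chunk p0021 L55)] -/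
theorem sub_label_vecMul_mem_rowSpX [DecidableEq κ] (C : CSSCode RX RZ Q) {LX LZ : Matrix κ Q (ZMod 2)}
    (hLZ : ∀ a, C.HX *ᵥ LZ a = 0) (hpair : LZ * LXᵀ = 1) {x : Q → ZMod 2}
    (hdec : ∃ c : κ → ZMod 2, x - ∑ i, c i • LX i ∈ C.rowSpX) :
    x - (LZ *ᵥ x) ᵥ* LX ∈ C.rowSpX :=
  C.swap.sub_label_vecMul_mem_rowSpZ hLZ hpair hdec

end CSSCode

end Literature.InformationTheory.QuantumCodes
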